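import Summits.CriticalPhenomena.SAWScalingLimit.Theorems.SAWLoopFugacityFlowAvoidanceLimitCrosscutSeparation
import Summits.CriticalPhenomena.SAWScalingLimit.Theorems.SAWLoopFugacityFlowAvoidanceLimitWallsSeparatePolyline
import Literature.Probability.LatticeModels.GermRegionLattice
import HarnessLib

/-!
# Two lattice walls ending at a T-death and a B-death separate the inner exits from the outer exits

Sub-problem `CriticalPhenomena/SAWScalingLimit`, crux `AvoidanceLimit`, line `symplectic-fermion-anchor` (lead c7), stub
`walls_separate` of `stub_germTwoSided` (Chelkak 2016 Prop. 3.3: "due to topological reasons, the walk should cross at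
least one of those two paths"), in the edge-killed germ setting and with the LAST INCH of lead c7's audit (crux NOTES.md
§"hcore after lead c7" (S2)): the walls are two kept lattice walks `pT : zc → xT`, `pB : zc → xB` of `Ω^δ` from a common
site, ending at DEATH sites — `xT` has a non-kept lattice direction `eT` whose edge lands (`edgeLanding`, first boundary
point of the segment) on the OPEN T-lateral `∂D(σ',θ₁)`, `xB` likewise on the open B-lateral `∂D(θ₂,τ')` — all wall
sites in `Θ'`, at distance `> 2δ` from `closure U(s)` and from the outer gate arc (the hypothesis that the other wall
sites are `> δ` from `∂D` is not needed). Then every walk of `Ω^δ` from an inner exit `u ∈ germExits(s)` to an outer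
exit `x ∈ germExits(s')` whose sites before `x` lie in `Θ'` passes through a wall site.

Proof. The wall polyline `Λ = [q_T, δxT] ∪ meshTrace(path xT → xB inside the supports) ∪ [δxB, q_B]`
(`exists_wall_arc`, file `…WallsSeparatePolyline.lean`) is a simple arc in `D̄` from `q_T = D.boundary φ_T` to
`q_B = D.boundary φ_B`, grid-compatible (a kept edge meeting `Λ` has an end on the wall), each point within `δ` of a
wall site — so `Λ` misses the outer gate arc and `closure U(s)`, hence lies in `closure U'` (it is connected, meets
`U'`, and `closure U' ∩ closure Far' ⊆ gateArc'`), and `Λ ∩ ∂D ⊆ ∂D[σ',θ₁] ∪ ∂D[θ₂,τ']` (frontier identities). The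
polyline need not be a cross-cut (a kept edge `[δxT, δxB]` may touch `∂D`), but its sub-arc from the LAST visit of
`∂D[σ',θ₁]` to the FIRST later visit of `∂D[θ₂,τ']` (`exists_subarc_between`) is a cross-cut of `D` from
`D.boundary α` to `D.boundary β`, `σ' < α < θ₁ < θ₂ < β < τ'` (ends `σ'`, `τ'` are gate ends, `θ₁`, `θ₂` lie on
`closure U(s)`). Newman's separation of lattice walks (`exists_mem_support_of_crosscut`, p146642) with the
certificates `S₁ = closure U(s) ∪ [δu', δu]` (through `D.boundary ((θ₁+θ₂)/2)`) and `S₂ = gateArc' ∪ [δx'', δx]`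
(through the gate end `D.boundary τ'`) — after the trivial cases `u ∈ W`, `x'' ∈ W` — finishes the proof.
[cite: Chelkak2016, Proposition 3.3; Newman1939, Ch. V §11, Thms. 11·7–11·8]
-/

noncomputable section

open scoped BigOperators Classical Topology
open Set Metric Filter AffineMap
open Literature.Topology.PlaneTopology
open Literature.Probability.LatticeModels
open Literature.Probability.RandomPlanarGeometry (JordanDomain)

namespace Summit.CriticalPhenomena.SAWScalingLimit.Theorems.AvoidanceLimit.Anchor

/-! ### A sub-arc between two closed sets -/

/-- **Sub-arc between two closed sets.** If a simple arc `Λ` runs from a point of a closed set `T`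
to a point of a closed set `B`, no point of `Λ` lies in both, and every point of `Λ` off `T ∪ B`
lies in `Ω`, then some sub-arc of `Λ` runs from a point of `T` to a point of `B` with all its
other points in `Ω` (last visit to `T`, then first visit to `B`). [folklore] -/
theorem exists_subarc_between {Λ T B Ω : Set ℂ} {p q : ℂ} (hΛ : IsSimpleArc Λ p q)
    (hT : IsClosed T) (hB : IsClosed B) (hp : p ∈ T) (hq : q ∈ B)
    (hTB : ∀ z ∈ Λ, z ∈ T → z ∉ B) (hcov : ∀ z ∈ Λ, z ∉ T → z ∉ B → z ∈ Ω) :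
    ∃ (L : Set ℂ) (a c : ℂ), L ⊆ Λ ∧ IsSimpleArc L a c ∧ a ∈ T ∧ c ∈ B ∧ L \ {a, c} ⊆ Ω := by
  obtain ⟨γ, hγ, hinj, hL, h0, h1⟩ := isSimpleArc_iff_continuous.1 hΛ
  have hmem : ∀ t ∈ Icc (0 : ℝ) 1, γ t ∈ Λ := fun t ht => hL ▸ mem_image_of_mem γ ht
  -- last visit to `T`
  set ΦT : Set ℝ := Icc 0 1 ∩ γ ⁻¹' T with hΦT
  have hΦTc : IsClosed ΦT := isClosed_Icc.inter (hT.preimage hγ)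
  have hΦT0 : (0 : ℝ) ∈ ΦT := ⟨left_mem_Icc.2 zero_le_one, by rw [mem_preimage, h0]; exact hp⟩
  have hΦTbdd : BddAbove ΦT := ⟨1, fun t ht => ht.1.2⟩
  set s := sSup ΦT with hs
  have hsΦ : s ∈ ΦT := hΦTc.csSup_mem ⟨0, hΦT0⟩ hΦTbdd
  have hs1 : s < 1 := by
    rcases hsΦ.1.2.eq_or_lt with h | h
    · exact absurd (h1 ▸ hq : γ 1 ∈ B) (hTB _ (hmem s hsΦ.1) hsΦ.2 ∘ fun hb => by rwa [h])
    · exact h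
  -- first visit to `B` after `s`
  set ΦB : Set ℝ := Icc s 1 ∩ γ ⁻¹' B with hΦB
  have hΦBc : IsClosed ΦB := isClosed_Icc.inter (hB.preimage hγ)
  have hΦB1 : (1 : ℝ) ∈ ΦB := ⟨right_mem_Icc.2 hs1.le, by rw [mem_preimage, h1]; exact hq⟩
  have hΦBbdd : BddBelow ΦB := ⟨s, fun t ht => ht.1.1⟩
  set t := sInf ΦB with ht
  have htΦ : t ∈ ΦB := hΦBc.csInf_mem ⟨1, hΦB1⟩ hΦBbdd
  have ht1 : t ≤ 1 := htΦ.1.2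
  have hst : s < t := by
    rcases htΦ.1.1.eq_or_lt with h | h
    · exact absurd (h ▸ htΦ.2 : γ s ∈ B) (hTB _ (hmem s hsΦ.1) hsΦ.2)
    · exact h
  have hsub : Icc s t ⊆ Icc (0 : ℝ) 1 := Icc_subset_Icc hsΦ.1.1 ht1
  -- points strictly between are off `T` and off `B`
  have hmid : ∀ u ∈ Ioo s t, γ u ∈ Ω := by
    intro u hu
    have hu01 : u ∈ Icc (0 : ℝ) 1 := hsub (Ioo_subset_Icc_self hu)
    refine hcov _ (hmem u hu01) (fun huT => ?_) (fun huB => ?_)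
    · have : u ≤ s := le_csSup hΦTbdd ⟨hu01, huT⟩
      linarith [hu.1]
    · have : t ≤ u := csInf_le hΦBbdd ⟨⟨hu.1.le, hu01.2⟩, huB⟩
      linarith [hu.2]
  -- the sub-arc
  set a : ℝ → ℝ := fun v => s + v * (t - s) with ha
  have hac : Continuous a := by fun_prop
  have ha_maps : ∀ v ∈ Icc (0 : ℝ) 1, a v ∈ Icc s t := fun v hv =>
    ⟨by simp only [ha]; nlinarith [hv.1], by simp only [ha]; nlinarith [hv.2]⟩
  have ha_img : a '' Icc 0 1 = Icc s t := by
    apply Subset.antisymm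
    · rintro _ ⟨v, hv, rfl⟩; exact ha_maps v hv
    · intro θ hθ
      refine ⟨(θ - s) / (t - s), ⟨div_nonneg (by linarith [hθ.1]) (by linarith),
        (div_le_one (by linarith)).2 (by linarith [hθ.2])⟩, ?_⟩
      show s + (θ - s) / (t - s) * (t - s) = θ
      rw [div_mul_cancel₀ _ (by linarith : t - s ≠ 0)]; ring
  refine ⟨γ '' Icc s t, γ s, γ t, by rw [← hL]; exact image_mono hsub, ?_, hsΦ.2, htΦ.2, ?_⟩
  · refine isSimpleArc_iff_continuous.2 ⟨fun v => γ (a v), hγ.comp hac, ?_, ?_, ?_, ?_⟩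
    · intro v hv v' hv' hvv'
      have h := hinj (hsub (ha_maps v hv)) (hsub (ha_maps v' hv')) hvv'
      simp only [ha] at h
      have : (v - v') * (t - s) = 0 := by linarith
      rcases mul_eq_zero.1 this with h' | h'
      · linarith
      · linarith
    · rw [show (fun v => γ (a v)) = γ ∘ a from rfl, image_comp, ha_img]
    · simp [ha]
    · simp [ha]
  · rintro z ⟨⟨v, hv, rfl⟩, hz⟩
    have hvs : v ≠ s := fun h => hz (Or.inl (by rw [h]))
    have hvt : v ≠ t := fun h => hz (Or.inr (by rw [h]; rfl))
    exact hmid v ⟨lt_of_le_of_ne hv.1 (Ne.symm hvs), lt_of_le_of_ne hv.2 hvt⟩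

/-! ### The separation -/

/-- **Two walls landing on the two laterals separate inner exits from outer exits.** See the module docstring.
[cite: Chelkak2016, Proposition 3.3] -/
theorem walls_separate :
    ∀ (D : JordanDomain) (b : ℂ) (s s' : ℝ) (hs : 0 < s) (hs' : 0 < s'), s < s' → ∀ (g o : ℂ),
      TwoOff D (boxJD b hs) → TwoOff D (boxJD b hs') →
      g ∈ D.carrier ∩ Literature.Topology.PlaneTopology.box b s → o ∈ D.carrier → o ∉ closedBox b s' →
    ∀ (σ' θ₁ θ₂ τ' : ℝ), σ' < θ₁ → θ₁ < θ₂ → θ₂ < τ' → τ' < σ' + 1 →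
      frontier (germRegion D b hs' g o) =
        gateArc D (boxJD b hs') (germGateParam D b hs' g o) ∪ D.boundary '' Set.Icc σ' τ' →
      frontier (germRegion D b hs g o) =
        gateArc D (boxJD b hs) (germGateParam D b hs g o) ∪ D.boundary '' Set.Icc θ₁ θ₂ →
      ({D.boundary θ₁, D.boundary θ₂} : Set ℂ) =
        {(boxJD b hs).boundary (gateLo D (boxJD b hs) (germGateParam D b hs g o)),
         (boxJD b hs).boundary (gateHi D (boxJD b hs) (germGateParam D b hs g o))} →
      ({D.boundary σ', D.boundary τ'} : Set ℂ) =
        {(boxJD b hs').boundary (gateLo D (boxJD b hs') (germGateParam D b hs' g o)),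
         (boxJD b hs').boundary (gateHi D (boxJD b hs') (germGateParam D b hs' g o))} →
    ∀ (δ : ℝ), 0 < δ → ∀ (zc xT xB : Site 2) (pT : (discreteDomainGraph D.carrier δ).Walk zc xT)
      (pB : (discreteDomainGraph D.carrier δ).Walk zc xB) (eT eB : SRW.Dir 2),
      ¬ (discreteDomainGraph D.carrier δ).Adj xT (xT + SRW.stepVec eT) →
      edgeLanding D.carrier δ xT eT ∈ D.boundary '' Set.Ioo σ' θ₁ →
      ¬ (discreteDomainGraph D.carrier δ).Adj xB (xB + SRW.stepVec eB) →
      edgeLanding D.carrier δ xB eB ∈ D.boundary '' Set.Ioo θ₂ τ' →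
      (∀ v, v ∈ pT.support ∨ v ∈ pB.support → v ∈ germSites D b hs' g o δ ∧
        2 * δ < Metric.infDist (meshPoint δ v) (closure (germRegion D b hs g o)) ∧
        (∀ p ∈ gateArc D (boxJD b hs') (germGateParam D b hs' g o), 2 * δ < dist (meshPoint δ v) p) ∧
        (v ≠ xT → v ≠ xB → δ < Metric.infDist (meshPoint δ v) (frontier D.carrier))) →
    ∀ u ∈ germExits D b hs g o δ, u ∈ germSites D b hs' g o δ → ∀ x ∈ germExits D b hs' g o δ,
      ∀ (w : (discreteDomainGraph D.carrier δ).Walk u x), (∀ v ∈ w.support, v ≠ x → v ∈ germSites D b hs' g o δ) →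
      ∃ v ∈ w.support, v ∈ pT.support ∨ v ∈ pB.support := by
  intro D b s s' hs hs' hss' g o h2 h2' hg ho hoc σ' θ₁ θ₂ τ' hσθ hθθ hθτ hτσ hfU' hfU _hendsU hends δ hδ
    zc xT xB pT pB eT eB hT hqT hB hqB hwall u hu huΘ x hx w hwΘ
  have hg' : g ∈ D.carrier ∩ Literature.Topology.PlaneTopology.box b s' :=
    ⟨hg.1, Literature.Topology.PlaneTopology.box_mono hss'.le hg.2⟩
  have hocs : o ∉ closedBox b s := fun h => hoc (closedBox_mono hss'.le h)
  obtain ⟨ht₀', -, -⟩ := germGateParam_spec h2' hg' ho hoc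
  have hgq' : g ∈ D.carrier \ gate D (boxJD b hs') (germGateParam D b hs' g o) :=
    base_not_mem_gate hs' hg' _
  -- (0) trivial cases: `u` on the wall; the site `x''` before `x` on the wall
  by_cases huW : u ∈ pT.support ∨ u ∈ pB.support
  · exact ⟨u, w.start_mem_support, huW⟩
  have hxΘ : x ∉ germSites D b hs' g o δ := (mem_germExits_iff.1 hx).1
  have hux : u ≠ x := fun h => hxΘ (h ▸ huΘ)
  obtain ⟨x'', hxx'', p', hp'⟩ := SimpleGraph.Walk.exists_eq_cons_of_ne (Ne.symm hux) w.reverse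
  have hx''w : x'' ∈ w.support := by
    have h : x'' ∈ w.reverse.support := by
      rw [hp']; exact List.mem_cons_of_mem _ p'.start_mem_support
    rwa [SimpleGraph.Walk.support_reverse, List.mem_reverse] at h
  have hx''Θ : x'' ∈ germSites D b hs' g o δ := hwΘ x'' hx''w hxx''.ne.symm
  by_cases hx''W : x'' ∈ pT.support ∨ x'' ∈ pB.support
  · exact ⟨x'', hx''w, hx''W⟩
  -- (1) the wall
  obtain ⟨φT, hφT, hφTq⟩ := hqT
  obtain ⟨φB, hφB, hφBq⟩ := hqB
  have hqne : edgeLanding D.carrier δ xT eT ≠ edgeLanding D.carrier δ xB eB := by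
    rw [← hφTq, ← hφBq]
    intro h
    have := D.injOn_boundary_Ico σ' ⟨hφT.1.le, by linarith [hφT.2]⟩
      ⟨by linarith [hφB.1], by linarith [hφB.2]⟩ h
    linarith [hφT.2, hφB.1]
  obtain ⟨Λ, hΛarc, hΛD, hxTΛ, hΛnear, hΛgrid⟩ :=
    exists_wall_arc D δ hδ zc xT xB pT pB eT eB hT hB hqne fun v hv => (hwall v hv).1.1
  have hΛgate : ∀ z ∈ Λ, z ∉ gateArc D (boxJD b hs') (germGateParam D b hs' g o) := by
    intro z hz hzg
    obtain ⟨v, hv, hzv⟩ := hΛnear z hz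
    have := (hwall v hv).2.2.1 z hzg
    rw [dist_comm] at hzv
    linarith
  have hΛU : ∀ z ∈ Λ, z ∉ closure (germRegion D b hs g o) := by
    intro z hz hzU
    obtain ⟨v, hv, hzv⟩ := hΛnear z hz
    have h1 := (hwall v hv).2.1
    have h2 : infDist (meshPoint δ v) (closure (germRegion D b hs g o)) ≤ dist (meshPoint δ v) z :=
      infDist_le_dist_of_mem hzU
    rw [dist_comm] at hzv
    linarith
  -- (2) the wall lies in the closure of the outer germ region
  have hΛU' : Λ ⊆ closure (germRegion D b hs' g o) := by
    have hDsub : closure D.carrier ⊆ closure (germRegion D b hs' g o) ∪ closure (germFar D b hs' g o) ∪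
        gateArc D (boxJD b hs') (germGateParam D b hs' g o) := by
      have h1 : D.carrier ⊆ germRegion D b hs' g o ∪ germFar D b hs' g o ∪
          gateArc D (boxJD b hs') (germGateParam D b hs' g o) := fun z hz => by
        by_cases hzg : z ∈ germGate D b hs' g o
        · exact Or.inr (gate_subset_gateArc _ hzg)
        · have : z ∈ germRegion D b hs' g o ∪ germFar D b hs' g o := by
            rw [germRegion_union_germFar]; exact ⟨hz, hzg⟩
          exact Or.inl this
      calc closure D.carrier ⊆ closure (germRegion D b hs' g o ∪ germFar D b hs' g o ∪
            gateArc D (boxJD b hs') (germGateParam D b hs' g o)) := closure_mono h1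
        _ = _ := by rw [closure_union, closure_union, (isClosed_gateArc _).closure_eq]
    have hcov : Λ ⊆ closure (germRegion D b hs' g o) ∪ closure (germFar D b hs' g o) := fun z hz => by
      rcases hDsub (hΛD hz) with h | h
      · exact h
      · exact absurd h (hΛgate z hz)
    by_contra hnot
    obtain ⟨z, hz, hzU'⟩ := not_subset.1 hnot
    exact false_of_preconnected_meets_both_sides isClosed_closure isClosed_closure
      (closure_gateSide_inter_closure_gateFar h2' ht₀' hgq') hΛarc.isConnected.isPreconnected hcov
      (Set.disjoint_left.2 hΛgate)
      ⟨_, hxTΛ, subset_closure (hwall xT (Or.inl pT.end_mem_support)).1.2⟩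
      ⟨z, hz, (hcov hz).resolve_left hzU'⟩
  -- (3) the closed lateral arcs and the sub-arc cross-cut
  have hTTc : IsClosed (D.boundary '' Icc σ' θ₁) := (isCompact_Icc.image D.continuous_boundary).isClosed
  have hBBc : IsClosed (D.boundary '' Icc θ₂ τ') := (isCompact_Icc.image D.continuous_boundary).isClosed
  have hTB : ∀ z ∈ Λ, z ∈ D.boundary '' Icc σ' θ₁ → z ∉ D.boundary '' Icc θ₂ τ' := by
    rintro z - ⟨ψ₁, hψ₁, rfl⟩ ⟨ψ₂, hψ₂, h⟩
    have := D.injOn_boundary_Ico σ' ⟨by linarith [hψ₂.1], by linarith [hψ₂.2]⟩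
      ⟨hψ₁.1, by linarith [hψ₁.2]⟩ h
    linarith [hψ₁.2, hψ₂.1]
  have hcovD : ∀ z ∈ Λ, z ∉ D.boundary '' Icc σ' θ₁ → z ∉ D.boundary '' Icc θ₂ τ' → z ∈ D.carrier := by
    intro z hz hzT hzB
    by_contra hzD
    have hzfr : z ∈ frontier (germRegion D b hs' g o) := by
      rw [(isOpen_germRegion h2' hg' ho hoc).frontier_eq]
      exact ⟨hΛU' hz, fun h => hzD (germRegion_subset_carrier h)⟩
    rw [hfU'] at hzfr
    rcases hzfr with h | ⟨ψ, hψ, rfl⟩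
    · exact hΛgate z hz h
    · by_cases h1 : ψ ≤ θ₁
      · exact hzT ⟨ψ, ⟨hψ.1, h1⟩, rfl⟩
      by_cases h2 : θ₂ ≤ ψ
      · exact hzB ⟨ψ, ⟨h2, hψ.2⟩, rfl⟩
      refine hΛU _ hz (frontier_subset_closure ?_)
      rw [hfU]; exact Or.inr ⟨ψ, ⟨(not_le.1 h1).le, (not_le.1 h2).le⟩, rfl⟩
  obtain ⟨L, a, c, hLΛ, hLarc, ⟨α, hα, rfl⟩, ⟨β, hβ, rfl⟩, hLD⟩ :=
    exists_subarc_between hΛarc hTTc hBBc ⟨φT, Ioo_subset_Icc_self hφT, hφTq⟩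
      ⟨φB, Ioo_subset_Icc_self hφB, hφBq⟩ hTB hcovD
  have haΛ : D.boundary α ∈ Λ := hLΛ hLarc.left_mem
  have hcΛ : D.boundary β ∈ Λ := hLΛ hLarc.right_mem
  -- the gate ends `D.boundary σ'`, `D.boundary τ'` are on the gate arc, hence off the wall
  have hlohi : gateLo D (boxJD b hs') (germGateParam D b hs' g o) ≤
      gateHi D (boxJD b hs') (germGateParam D b hs' g o) :=
    ((gateLo_lt h2' ht₀').trans (lt_gateHi h2' ht₀')).le
  have hendG : ∀ z ∈ ({D.boundary σ', D.boundary τ'} : Set ℂ),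
      z ∈ gateArc D (boxJD b hs') (germGateParam D b hs' g o) := by
    intro z hz
    rw [hends] at hz
    rcases hz with h | h
    · rw [h]; exact ⟨_, left_mem_Icc.2 hlohi, rfl⟩
    · rw [mem_singleton_iff.1 h]; exact ⟨_, right_mem_Icc.2 hlohi, rfl⟩
  have hσ'G := hendG _ (Or.inl rfl)
  have hτ'G := hendG _ (Or.inr rfl)
  have hα' : σ' < α ∧ α < θ₁ := by
    refine ⟨lt_of_le_of_ne hα.1 ?_, lt_of_le_of_ne hα.2 ?_⟩
    · intro h; rw [h] at hσ'G; exact hΛgate _ haΛ hσ'G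
    · intro h
      refine hΛU _ haΛ (frontier_subset_closure ?_)
      rw [hfU, h]; exact Or.inr ⟨θ₁, left_mem_Icc.2 hθθ.le, rfl⟩
  have hβ' : θ₂ < β ∧ β < τ' := by
    refine ⟨lt_of_le_of_ne hβ.1 ?_, lt_of_le_of_ne hβ.2 ?_⟩
    · intro h
      refine hΛU _ hcΛ (frontier_subset_closure ?_)
      rw [hfU, ← h]; exact Or.inr ⟨θ₂, right_mem_Icc.2 hθθ.le, rfl⟩
    · intro h; rw [← h] at hτ'G; exact hΛgate _ hcΛ hτ'G
  have hcross : D.IsCrosscut L (D.boundary α) (D.boundary β) :=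
    ⟨hLarc, D.boundary_mem_frontier α, D.boundary_mem_frontier β, hLarc.ne, hLD⟩
  have hgrid : ∀ a c : Site 2, (discreteDomainGraph D.carrier δ).Adj a c →
      (segment ℝ (meshPoint δ a) (meshPoint δ c) ∩ L).Nonempty →
      a ∈ {v | v ∈ pT.support ∨ v ∈ pB.support} ∨ c ∈ {v | v ∈ pT.support ∨ v ∈ pB.support} :=
    fun a c hac ⟨z, hz, hzL⟩ => hΛgrid a c hac ⟨z, hz, hLΛ hzL⟩
  -- (4) certificate for `u`: the closure of the inner germ region plus the kept edge `[δu', δu]`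
  obtain ⟨-, u', hu'Θ, -, -, hu'u⟩ := mem_germExits_iff.1 hu
  have hS₁pre : IsPreconnected (closure (germRegion D b hs g o) ∪ segment ℝ (meshPoint δ u') (meshPoint δ u)) :=
    IsPreconnected.union (meshPoint δ u') (subset_closure hu'Θ.2) (left_mem_segment ℝ _ _)
      (isConnected_germRegion h2 hg ho hocs).isPreconnected.closure (convex_segment _ _).isPreconnected
  have hS₁D : closure (germRegion D b hs g o) ∪ segment ℝ (meshPoint δ u') (meshPoint δ u) ⊆
      closure D.carrier :=
    union_subset (closure_mono germRegion_subset_carrier)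
      (meshGraph_adj_iff.1 (discreteDomainGraph_adj_iff.1 hu'u).1).2
  have hS₁L : Disjoint (closure (germRegion D b hs g o) ∪ segment ℝ (meshPoint δ u') (meshPoint δ u)) L := by
    refine Set.disjoint_left.2 ?_
    rintro z (hz | hz) hzL
    · exact hΛU z (hLΛ hzL) hz
    · rcases hgrid u' u hu'u ⟨z, hz, hzL⟩ with h | h
      · have h1 := (hwall u' h).2.1
        have h2 : infDist (meshPoint δ u') (closure (germRegion D b hs g o)) = 0 :=
          infDist_zero_of_mem (subset_closure hu'Θ.2)
        linarith
      · exact huW h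
  have hθS₁ : ∃ θ ∈ Ioo α β, D.boundary θ ∈
      closure (germRegion D b hs g o) ∪ segment ℝ (meshPoint δ u') (meshPoint δ u) := by
    refine ⟨(θ₁ + θ₂) / 2, ⟨by linarith [hα'.2], by linarith [hβ'.1]⟩, Or.inl (frontier_subset_closure ?_)⟩
    rw [hfU]; exact Or.inr ⟨_, ⟨by linarith, by linarith⟩, rfl⟩
  -- (5) certificate for `x`: the outer gate arc plus the kept edge `[δx'', δx]`, which meets it
  have hadj'' : (discreteDomainGraph D.carrier δ).Adj x'' x := hxx''.symm
  have hsegx : segment ℝ (meshPoint δ x'') (meshPoint δ x) ⊆ closure D.carrier :=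
    (meshGraph_adj_iff.1 (discreteDomainGraph_adj_iff.1 hadj'').1).2
  obtain ⟨pt, hptG, hptseg⟩ : ∃ pt ∈ gateArc D (boxJD b hs') (germGateParam D b hs' g o),
      pt ∈ segment ℝ (meshPoint δ x'') (meshPoint δ x) := by
    have hγc : ContinuousOn (fun t : ℝ => lineMap (meshPoint δ x'') (meshPoint δ x) t) (Icc 0 1) :=
      lineMap_continuous.continuousOn
    have hγseg : ∀ t ∈ Icc (0 : ℝ) 1, lineMap (meshPoint δ x'') (meshPoint δ x) t ∈
        segment ℝ (meshPoint δ x'') (meshPoint δ x) := fun t ht => by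
      rw [segment_eq_image_lineMap]; exact ⟨t, ht, rfl⟩
    have hxD : meshPoint δ x ∈ D.carrier :=
      meshDomain_subset_meshVertices _ _ (germExits_subset_meshDomain hx)
    have hxU' : meshPoint δ x ∉ germRegion D b hs' g o := fun h =>
      hxΘ ⟨germExits_subset_meshDomain hx, h⟩
    obtain ⟨t, ht, hpt⟩ := exists_mem_gateArc_of_path h2' ht₀' hgq' hγc
      (fun t ht => hsegx (hγseg t ht))
      (by simp only [lineMap_apply_zero]; exact hx''Θ.2)
      (by simp only [lineMap_apply_one]; exact hxD)
      (by simp only [lineMap_apply_one]; exact hxU')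
    exact ⟨_, hpt, hγseg t ht⟩
  have hS₂pre : IsPreconnected (gateArc D (boxJD b hs') (germGateParam D b hs' g o) ∪
      segment ℝ (meshPoint δ x'') (meshPoint δ x)) :=
    IsPreconnected.union pt hptG hptseg
      (by unfold gateArc; exact isPreconnected_Icc.image _ (boxJD b hs').continuous_boundary.continuousOn)
      (convex_segment _ _).isPreconnected
  have hS₂D : gateArc D (boxJD b hs') (germGateParam D b hs' g o) ∪
      segment ℝ (meshPoint δ x'') (meshPoint δ x) ⊆ closure D.carrier := by
    refine union_subset (fun z hz => ?_) hsegx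
    have : z ∈ frontier (germRegion D b hs' g o) := by rw [hfU']; exact Or.inl hz
    exact closure_mono germRegion_subset_carrier (frontier_subset_closure this)
  have hS₂L : Disjoint (gateArc D (boxJD b hs') (germGateParam D b hs' g o) ∪
      segment ℝ (meshPoint δ x'') (meshPoint δ x)) L := by
    refine Set.disjoint_left.2 ?_
    rintro z (hz | hz) hzL
    · exact hΛgate z (hLΛ hzL) hz
    · rcases hgrid x'' x hadj'' ⟨z, hz, hzL⟩ with h | h
      · exact hx''W h
      · exact hxΘ (hwall x h).1
  have hθS₂ : ∃ θ ∈ Ioo β (α + 1), D.boundary θ ∈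
      gateArc D (boxJD b hs') (germGateParam D b hs' g o) ∪ segment ℝ (meshPoint δ x'') (meshPoint δ x) :=
    ⟨τ', ⟨hβ'.2, by linarith [hα'.1]⟩, Or.inl hτ'G⟩
  exact exists_mem_support_of_crosscut D δ hδ L α β (by linarith [hα'.2, hβ'.1])
    (by linarith [hα'.1, hβ'.2]) hcross {v | v ∈ pT.support ∨ v ∈ pB.support} hgrid u x w _ _ hS₁pre
    hS₁D hS₁L (Or.inr (right_mem_segment ℝ _ _)) hθS₁ hS₂pre hS₂D hS₂L
    (Or.inr (right_mem_segment ℝ _ _)) hθS₂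

end Summit.CriticalPhenomena.SAWScalingLimit.Theorems.AvoidanceLimit.Anchor

end
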